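import Literature.NumberTheory.EllipticCurves.RohrlichNonvanishingCoeffFieldProofs
import Literature.NumberTheory.EllipticCurves.AtkinLehnerSymbolSymmetryProofs
import HarnessLib

/-!
# Rohrlich's first moment at a prime DIVIDING the level, I: the two-sided series and the family
# identity with the Atkin–Lehner involution `w_Q`, `Q = N/p^a`, in place of the Fricke involution

Cell `pub/bsd-wall` (D-0145 line `route-BirchSwinnertonDyer-CyclotomicUntwist`), seat `bsd-line-cycu-p1`
(prover seat 1/3), helper toward crux K1 `PSRankOneLowerHalfAtThree` (stmt-BirchSwinnertonDyer-21580):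
the non-vanishing input `𝓛_p(f, η̄, ·) ≢ 0` of the untwisted `p`-adic `L`-function
(`CyclotomicUntwistUntwistedNonvanishing.exists_apply_ne_zero_of_rohrlich`) needs Rohrlich's theorem for
twists of `p`-power conductor at a prime `p ∣ N` (the Pollack–Stevens rows have `9 ∣ N`), which the
tree's `Rohrlich1984_primePow_of_coeffField_eq_bot` (`RohrlichNonvanishingProofs`) excludes by its
hypothesis `p ∤ N`. THEOREMS ONLY (no definition, no named fact, no `sorry`); BSD is not proved by this
file and no crux is.

The point. In the tree's proof `p ∤ N` enters only through the flip
`[1, u/m; 0, 1] w_{Nm²} = m γ w_N [1, v/m; 0, 1]` (`TwistedLValueSeries`) and the weight `χ(N)` of the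
dual term. For `N = Q · p^a` with `p ∤ Q` and `m = p^n`, `n ≥ a`, the same computation with the
ATKIN–LEHNER matrix `(Qv, −a'; Qm, −Qu)` (a version of `w(Q)`, Knapp 1993, Lemma 9.24) gives
`f(u/m + it) = −ε_Q f(v/m + i/(Q m² t))/(Q m² t²)`, `a' m − u Q v = 1` — this is the tree's
`apply_ofComplex_eq_of_atkinLehner` / `modularSymbol_eq_rayTail_sub_atkinLehner`
(`AtkinLehnerSymbolSymmetryProofs`, there for the functional equation of the `p`-adic `L`-function at
`p ∥ N`). Hence Rohrlich's argument (1984, §§2–4) runs verbatim with `(N, w_N)` replaced by `(Q, w_Q)`: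

* §1 `twistedSymbolSum_inv_eq_dampedTwist_atkinLehner` — for `w_Q f = ε f`, `ε² = 1`, `N ∣ Q m`,
  `(m, Q) = 1`, `χ` primitive mod `m`:
  `∑_a χ̄(a){∞, a/m}_f = τ(χ̄) D_f(χ, Y) − ε χ̄(−1) χ(Q) τ(χ) D_f(χ̄, 1/(Q m² Y))`.
* §2 `sum_family_twistedSymbolSum_eq_atkinLehner` — the first-moment identity over a family `X` of
  primitive characters mod `p^n` of constant parity `ε_X`:
  `∑_{χ ∈ X} (τ(χ)/p^n) ∑_a χ̄(a){∞, a/p^n}_f = ε_X (D_f(A, Y) − ε p^{-n} D_f(B_Q, 1/(Q p^{2n} Y)))`,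
  `A = ∑_χ χ`, `B_Q(k) = ∑_χ χ(Q) τ(χ)² χ̄(k)`.
* §3 `norm_dampedTwist_le_of_norm_le` — `‖D_f(w, y)‖ ≤ K C (1 + Γ(θ)(2πy)^{-θ})` for `‖w‖ ≤ K`,
  `|aₙ| ≤ C n^θ`, `0 < θ ≤ 1`; and `norm_dampedTwist_dual_le_of_support_unit` — the dual-term error
  for a sparse family with the weight `χ(c)`, `p ∤ c` (the tree's `norm_dampedTwist_dual_le_of_support`
  has `c = N`, `p ∤ N`).

Part II (`CyclotomicUntwistRohrlichAtkinLehnerMoment`) runs the asymptotics; part III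
(`CyclotomicUntwistRohrlichBadPrimes`) assembles Rohrlich's theorem at `p ∣ N` for rational newforms
and discharges the Rohrlich hypothesis of the untwisted non-vanishing theorem.

References: [cite: RohrlichInventiones1984, §§2–4]; [cite: Knapp1993, Lemma 9.24];
[cite: MazurTateTeitelbaum1986Invent, §I.17]; Kato, Astérisque 295 (2004), Thm. 13.5 (2) (p. 227,
quoting Rohrlich, Math. Ann. 281 (1988): finiteness for ANY finite set of primes `S`, no condition
`S ∤ N`).
-/

noncomputable section

open scoped MatrixGroups Real

open CongruenceSubgroup Literature.NumberTheory.EllipticCurves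
  Literature.NumberTheory.EllipticCurves.ModularForms UpperHalfPlane Finset

-- single-conjunct summit: `Summit.BirchSwinnertonDyer.BirchSwinnertonDyer.…` repeats the name by design
set_option linter.dupNamespace false
set_option autoImplicit false

namespace Summit.BirchSwinnertonDyer.BirchSwinnertonDyer.Theorems.PSRohrlichAL

variable {N : ℕ} [NeZero N] (f : CuspForm (Gamma0 N) 2) {Q : ℕ} [NeZero Q]

/-! ### §1 The two-sided series for the twisted symbol sums, Atkin–Lehner form -/

section Series

variable {m : ℕ} [NeZero m]

/-- **Two-sided series for the twisted symbol sums, Atkin–Lehner form.** Let `f ∈ S₂(Γ₀(N))` with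
`w_Q f = ε f` (`Q ∥ N`, `ε² = 1`), `m ≥ 1` with `N ∣ Q m` and `(m, Q) = 1`, `χ` a primitive Dirichlet
character mod `m`, `Y > 0`. Then
`∑_{a mod m} χ̄(a){∞, a/m}_f = τ(χ̄) D_f(χ, Y) − ε χ̄(−1) χ(Q) τ(χ) D_f(χ̄, 1/(Q m² Y))`
(the tree's `twistedSymbolSum_inv_eq_dampedTwist` is the Fricke case `Q = N`, `(m, N) = 1`; here `m`
may be divisible by the primes of `N/Q`). Proof: `modularSymbol_eq_rayTail_sub_atkinLehner` at the units
`a`, `v ≡ −(aQ)⁻¹ (mod m)` (`exists_int_flip`), then the Gauss sums `sum_inv_mul_stdAddChar`,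
`sum_inv_mul_stdAddChar_flip`. [cite: RohrlichInventiones1984, §2] [cite: Knapp1993, Lemma 9.24] -/
theorem twistedSymbolSum_inv_eq_dampedTwist_atkinLehner (hQN : Q ∣ N) (hc : Nat.Coprime Q (N / Q))
    {ε : ℂ} (hε : atkinLehnerInvolution N 2 Q f = ε • f) (hε1 : ε ^ 2 = 1) (hNm : N ∣ Q * m)
    (hmQ : m.Coprime Q) {χ : DirichletCharacter ℂ m} (hχ : χ.IsPrimitive) {Y : ℝ} (hY : 0 < Y) :
    twistedSymbolSum f χ⁻¹ =
      gaussSum χ⁻¹ (ZMod.stdAddChar (N := m)) * dampedTwist f (fun n ↦ χ n) Y -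
        ε * (χ⁻¹ (-1) * χ Q * gaussSum χ (ZMod.stdAddChar (N := m))) *
          dampedTwist f (fun n ↦ χ⁻¹ n) (1 / ((Q : ℝ) * m ^ 2 * Y)) := by
  have hQ : (0 : ℝ) < Q := Nat.cast_pos.mpr (NeZero.pos Q)
  have hY' : 0 < 1 / ((Q : ℝ) * m ^ 2 * Y) := by
    have : (0 : ℝ) < m := Nat.cast_pos.mpr (NeZero.pos m)
    positivity
  set V : ZMod m → ZMod m := fun x ↦ -(x * (Q : ZMod m))⁻¹ with hV
  -- the two-sided formula at the units
  have hunit : ∀ x : ZMod m, IsUnit x → modularSymbol f ((x.val : ℚ) / m) =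
      rayTail f ((x.val : ℚ) / m) Y -
        ε * rayTail f (((V x).val : ℚ) / m) (1 / ((Q : ℝ) * m ^ 2 * Y)) := by
    intro x hx
    obtain ⟨a, ha⟩ := exists_int_flip hmQ hx
    have h := modularSymbol_eq_rayTail_sub_atkinLehner hQN hc f hε hε1 (NeZero.pos m) hNm ha hY
    simpa only [Int.cast_natCast] using h
  -- expand the twisted symbol sum
  have hexp : twistedSymbolSum f χ⁻¹ =
      ∑ x : ZMod m, χ⁻¹ x * rayTail f ((x.val : ℚ) / m) Y -
        ε * ∑ x : ZMod m, χ⁻¹ x * rayTail f (((V x).val : ℚ) / m)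
          (1 / ((Q : ℝ) * m ^ 2 * Y)) := by
    rw [twistedSymbolSum, Finset.mul_sum, ← Finset.sum_sub_distrib]
    refine Finset.sum_congr rfl fun x _ ↦ ?_
    by_cases hx : IsUnit x
    · rw [hunit x hx]; ring
    · rw [MulChar.map_nonunit _ hx]; ring
  have hA : ∑ x : ZMod m, χ⁻¹ x * rayTail f ((x.val : ℚ) / m) Y =
      gaussSum χ⁻¹ (ZMod.stdAddChar (N := m)) * dampedTwist f (fun n ↦ χ n) Y := by
    have h1 := sum_mul_rayTail_eq_tsum f (fun x ↦ χ⁻¹ x) id hY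
    simp only [id] at h1
    rw [h1, dampedTwist, ← tsum_mul_left]
    exact tsum_congr fun n ↦ by rw [sum_inv_mul_stdAddChar χ hχ n]; ring
  have hB : ∑ x : ZMod m, χ⁻¹ x * rayTail f (((V x).val : ℚ) / m) (1 / ((Q : ℝ) * m ^ 2 * Y)) =
      (χ⁻¹ (-1) * χ Q * gaussSum χ (ZMod.stdAddChar (N := m))) *
        dampedTwist f (fun n ↦ χ⁻¹ n) (1 / ((Q : ℝ) * m ^ 2 * Y)) := by
    rw [sum_mul_rayTail_eq_tsum f (fun x ↦ χ⁻¹ x) V hY', dampedTwist, ← tsum_mul_left]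
    refine tsum_congr fun n ↦ ?_
    rw [hV]
    dsimp only
    rw [sum_inv_mul_stdAddChar_flip hmQ χ n, gaussSum_mulShift_of_isPrimitive _ hχ]
    ring
  rw [hexp, hA, hB, ← mul_assoc]

end Series

/-! ### §2 The first-moment identity over a family, Atkin–Lehner form -/

section Family

variable {p : ℕ} [hp : Fact p.Prime]

/-- **The first-moment identity over a family, Atkin–Lehner form.** Let `f ∈ S₂(Γ₀(N))` with
`w_Q f = ε f` (`Q ∥ N`, `ε² = 1`, `p ∤ Q`), `N ∣ Q p^n`, `Y > 0`, `Y' = 1/(Q p^{2n} Y)`, and let `X` be a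
finite family of primitive characters mod `p^n` of constant parity `χ(−1) = ε_X`. Then
`∑_{χ ∈ X} (τ(χ)/p^n) ∑_a χ̄(a){∞, a/p^n}_f = ε_X (D_f(A, Y) − ε p^{-n} D_f(B_Q, Y'))`,
`A(k) = ∑_χ χ(k)`, `B_Q(k) = ∑_χ χ(Q) τ(χ)² χ̄(k)` (the tree's `sum_family_twistedSymbolSum_eq` is the
Fricke case; Rohrlich 1984, §§2–3). [cite: RohrlichInventiones1984, §§2–3] -/
theorem sum_family_twistedSymbolSum_eq_atkinLehner (hQN : Q ∣ N) (hc : Nat.Coprime Q (N / Q))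
    {ε : ℂ} (hε : atkinLehnerInvolution N 2 Q f = ε • f) (hε1 : ε ^ 2 = 1) (hpQ : ¬ p ∣ Q)
    {n : ℕ} [NeZero (p ^ n)] (hNn : N ∣ Q * p ^ n) (X : Finset (DirichletCharacter ℂ (p ^ n)))
    {εX : ℂ} (hX : ∀ χ ∈ X, χ.IsPrimitive ∧ χ (-1) = εX) {Y : ℝ} (hY : 0 < Y) :
    ∑ χ ∈ X, gaussSum χ (ZMod.stdAddChar (N := p ^ n)) / (p ^ n : ℂ) *
        twistedSymbolSum f χ⁻¹ =
      εX * (dampedTwist f (fun k ↦ ∑ χ ∈ X, χ k) Y -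
        ε * (1 / (p ^ n : ℂ)) * dampedTwist f (fun k ↦ ∑ χ ∈ X,
          χ Q * gaussSum χ (ZMod.stdAddChar (N := p ^ n)) ^ 2 * χ⁻¹ k)
            (1 / ((Q : ℝ) * (p ^ n : ℕ) ^ 2 * Y))) := by
  have hp' : p.Prime := Fact.out
  have hmQ : (p ^ n).Coprime Q := Nat.Coprime.pow_left _ ((Nat.Prime.coprime_iff_not_dvd hp').mpr hpQ)
  have hY' : 0 < 1 / ((Q : ℝ) * (p ^ n : ℕ) ^ 2 * Y) := by
    have : (0 : ℝ) < Q := Nat.cast_pos.mpr (NeZero.pos Q)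
    have : (0 : ℝ) < (p ^ n : ℕ) := Nat.cast_pos.mpr (NeZero.pos _)
    positivity
  have hpn : ((p ^ n : ℕ) : ℂ) ≠ 0 := Nat.cast_ne_zero.mpr (NeZero.ne _)
  -- termwise
  have hterm : ∀ χ ∈ X,
      gaussSum χ (ZMod.stdAddChar (N := p ^ n)) / (p ^ n : ℂ) * twistedSymbolSum f χ⁻¹ =
        εX * ((1 : ℂ) * dampedTwist f (fun k ↦ χ k) Y) -
          εX * (ε * (1 / (p ^ n : ℂ)) *
            ((χ Q * gaussSum χ (ZMod.stdAddChar (N := p ^ n)) ^ 2) *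
              dampedTwist f (fun k ↦ χ⁻¹ k) (1 / ((Q : ℝ) * (p ^ n : ℕ) ^ 2 * Y)))) := by
    intro χ hχ
    obtain ⟨hprim, hpar⟩ := hX χ hχ
    have h := twistedSymbolSum_inv_eq_dampedTwist_atkinLehner f hQN hc hε hε1 hNn hmQ hprim hY
    have hgg := Literature.NumberTheory.Sieve.LargeSieve.gaussSum_mul_gaussSum_inv hprim
    have h1 : χ⁻¹ (-1) = εX := by
      rw [MulChar.inv_apply_eq_inv', hpar]
      rcases apply_neg_one_eq_one_or χ with h' | h'
      · rw [← hpar, h', inv_one]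
      · rw [← hpar, h', inv_neg, inv_one]
    rw [hpar] at hgg
    push_cast at h hgg ⊢
    rw [h, h1]
    have hpn' : (p : ℂ) ^ n ≠ 0 := by exact_mod_cast hpn
    field_simp
    linear_combination dampedTwist f (fun k ↦ χ k) Y * hgg
  rw [Finset.sum_congr rfl hterm, Finset.sum_sub_distrib]
  have hA : ∑ χ ∈ X, εX * ((1 : ℂ) * dampedTwist f (fun k ↦ χ k) Y) =
      εX * dampedTwist f (fun k ↦ ∑ χ ∈ X, χ k) Y := by
    rw [← Finset.mul_sum, sum_mul_dampedTwist f X (fun _ ↦ (1 : ℂ))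
      (fun (χ : DirichletCharacter ℂ (p ^ n)) (k : ℕ) ↦ χ k) (B := 1)
      (fun χ k ↦ DirichletCharacter.norm_le_one χ _) hY]
    simp
  have hB : ∑ χ ∈ X, εX * (ε * (1 / (p ^ n : ℂ)) *
      ((χ Q * gaussSum χ (ZMod.stdAddChar (N := p ^ n)) ^ 2) *
        dampedTwist f (fun k ↦ χ⁻¹ k) (1 / ((Q : ℝ) * (p ^ n : ℕ) ^ 2 * Y)))) =
      εX * (ε * (1 / (p ^ n : ℂ)) * dampedTwist f (fun k ↦ ∑ χ ∈ X,
          χ Q * gaussSum χ (ZMod.stdAddChar (N := p ^ n)) ^ 2 * χ⁻¹ k)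
            (1 / ((Q : ℝ) * (p ^ n : ℕ) ^ 2 * Y))) := by
    rw [← Finset.mul_sum, ← Finset.mul_sum, sum_mul_dampedTwist f X _
      (fun (χ : DirichletCharacter ℂ (p ^ n)) (k : ℕ) ↦ χ⁻¹ k) (B := 1)
      (fun χ k ↦ DirichletCharacter.norm_le_one χ⁻¹ _) hY']
  rw [hA, hB, mul_sub]

end Family

/-! ### §3 The dual-term error with a unit weight `χ(c)`, `p ∤ c` -/

section Errors

variable {p : ℕ} [hp : Fact p.Prime]

omit [NeZero N] in
/-- **Damped sums with a bounded weight.** If `‖w(n)‖ ≤ K` and `|aₙ(f)| ≤ C n^θ` (`0 < θ ≤ 1`), then for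
`y > 0`: `‖D_f(w, y)‖ ≤ K · C · (1 + Γ(θ)(2πy)^{-θ})`, by the majorant
`K C n^{θ-1} e^{-2πny}` and `∑_{n ≥ 1} n^{θ-1} e^{-un} ≤ 1 + Γ(θ) u^{-θ}` (`sum_range_rpow_mul_exp_le`);
the second half of the tree's `norm_dampedTwist_dual_le_of_support`, isolated. [folklore] -/
theorem norm_dampedTwist_le_of_norm_le {w : ℕ → ℂ} {K : ℝ} (hK : 0 ≤ K) (hw : ∀ n, ‖w n‖ ≤ K)
    {C θ : ℝ} (hC : 0 ≤ C) (hθ : 0 < θ) (hθ1 : θ ≤ 1)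
    (ha : ∀ n : ℕ, ‖cuspCoeff f n‖ ≤ C * (n : ℝ) ^ θ) {y : ℝ} (hy : 0 < y) :
    ‖dampedTwist f w y‖ ≤ K * (C * (1 + Real.Gamma θ * (2 * Real.pi * y) ^ (-θ))) := by
  set c : ℝ := 2 * Real.pi * y with hc
  have hcpos : 0 < c := by positivity
  -- the majorant (zero at `n = 0`, where the term vanishes)
  set h : ℕ → ℝ := fun n ↦
    if n = 0 then 0 else K * C * ((n : ℝ) ^ (θ - 1) * Real.exp (-c * n)) with hh
  have hh0 : ∀ n, 0 ≤ h n := fun n ↦ by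
    simp only [hh]; split_ifs <;> positivity
  have hh_le : ∀ n, h n ≤ K * C * ((n : ℝ) ^ (θ - 1) * Real.exp (-c * n)) := fun n ↦ by
    simp only [hh]; split_ifs <;> first | positivity | exact le_rfl
  have hh_summable : Summable h :=
    Summable.of_nonneg_of_le hh0 hh_le ((summable_rpow_mul_exp hθ1 hcpos).mul_left _)
  have hpt : ∀ n : ℕ, ‖w n * cuspCoeff f n * (Real.exp (-(2 * Real.pi * n) * y) / n : ℝ)‖ ≤ h n := by
    intro n
    rcases Nat.eq_zero_or_pos n with rfl | hnpos
    · simp only [Nat.cast_zero, div_zero, Complex.ofReal_zero, mul_zero, norm_zero]; exact hh0 0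
    have hnr : (0 : ℝ) < n := Nat.cast_pos.mpr hnpos
    rw [norm_mul, norm_mul, Complex.norm_real, Real.norm_of_nonneg (by positivity), hh]
    dsimp only
    rw [if_neg hnpos.ne']
    calc ‖w n‖ * ‖cuspCoeff f n‖ * (Real.exp (-(2 * Real.pi * n) * y) / n)
        ≤ K * (C * (n : ℝ) ^ θ) * (Real.exp (-(2 * Real.pi * n) * y) / n) := by
          gcongr
          · exact hw n
          · exact ha n
      _ = K * C * ((n : ℝ) ^ (θ - 1) * Real.exp (-c * n)) := by
          rw [Real.rpow_sub_one hnr.ne', hc]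
          field_simp
  -- `∑ h ≤ K C (1 + Γ c^{-θ})`
  have htsum : ∑' n, h n ≤ K * C * (1 + Real.Gamma θ * c ^ (-θ)) := by
    have h0 : h 0 = 0 := by simp only [hh, if_pos rfl]
    rw [hh_summable.tsum_eq_zero_add, h0, zero_add]
    have h' : ∀ n : ℕ, h (n + 1) = K * C *
        ((((n + 1 : ℕ) : ℝ)) ^ (θ - 1) * Real.exp (-c * ((n + 1 : ℕ) : ℝ))) := fun n ↦ by
      simp only [hh, if_neg (Nat.succ_ne_zero n)]
    simp only [h']
    rw [tsum_mul_left]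
    refine mul_le_mul_of_nonneg_left ?_ (by positivity)
    refine Real.tsum_le_of_sum_range_le (fun n ↦ by positivity) fun M ↦ ?_
    exact sum_range_rpow_mul_exp_le hθ hθ1 hcpos M
  rw [dampedTwist]
  refine (tsum_of_norm_bounded hh_summable.hasSum hpt).trans (htsum.trans (le_of_eq ?_))
  rw [hc]; ring

omit [NeZero N] in
/-- **The dual-term error for a sparse family, unit weight.** For `f ∈ S₂(Γ₀(N))` with `|aₙ| ≤ C n^θ`
(`0 < θ ≤ 1`), a natural number `c` with `p ∤ c`, `n ≥ 1`, `Y' > 0`, and a family `X` of characters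
mod `p^n` with character sum supported in `{z : z^{2(p-1)} ≡ 1 (mod p^{n-1})}`:
`‖D_f(B_c, Y')‖ ≤ #X · C · (4p² · 4p^{⌈n/2⌉}) · (1 + Γ(θ)(2πY')^{-θ})`,
`B_c(k) = ∑_{χ ∈ X} χ(c) τ(χ)² χ̄(k)` — the tree's `norm_dampedTwist_dual_le_of_support` has `c = N`
(there `p ∤ N`); the Kloosterman bound `norm_sum_mul_gaussSum_sq_le_of_support` is unchanged.
[cite: RohrlichInventiones1984, §§3–4] -/
theorem norm_dampedTwist_dual_le_of_support_unit {n : ℕ} [NeZero (p ^ n)] (hn : n ≠ 0)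
    {c : ℕ} (hpc : ¬ p ∣ c) (X : Finset (DirichletCharacter ℂ (p ^ n)))
    (hsupp : ∀ z : ZMod (p ^ n), ∑ χ ∈ X, χ z ≠ 0 →
      (ZMod.castHom (pow_dvd_pow p (Nat.sub_le n 1)) (ZMod (p ^ (n - 1))) z) ^ (2 * (p - 1)) = 1)
    {C θ : ℝ} (hC : 0 ≤ C) (hθ : 0 < θ) (hθ1 : θ ≤ 1)
    (ha : ∀ k : ℕ, ‖cuspCoeff f k‖ ≤ C * (k : ℝ) ^ θ) {Y' : ℝ} (hY' : 0 < Y') :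
    ‖dampedTwist f (fun k ↦ ∑ χ ∈ X,
        χ c * gaussSum χ (ZMod.stdAddChar (N := p ^ n)) ^ 2 * χ⁻¹ k) Y'‖ ≤
      X.card * (C * (((4 * p * p : ℕ) * (4 * (p : ℝ) ^ (n - n / 2))) *
        (1 + Real.Gamma θ * (2 * Real.pi * Y') ^ (-θ)))) := by
  classical
  set β : ℝ := (4 * p * p : ℕ) * (4 * (p : ℝ) ^ (n - n / 2)) with hβ
  have hβ0 : 0 ≤ β := by positivity
  set Bw : ℕ → ℂ := fun k ↦ ∑ χ ∈ X, χ c * gaussSum χ (ZMod.stdAddChar (N := p ^ n)) ^ 2 * χ⁻¹ k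
    with hBw
  have hcu : IsUnit ((c : ℕ) : ZMod (p ^ n)) := by
    rw [ZMod.isUnit_iff_coprime]
    exact ((Nat.Prime.coprime_iff_not_dvd hp.out).mpr hpc).symm.pow_right n
  -- bound for the weight
  have hBle : ∀ k : ℕ, ‖Bw k‖ ≤ X.card * β := by
    intro k
    by_cases hk : IsUnit ((k : ℕ) : ZMod (p ^ n))
    · have : Bw k = ∑ χ ∈ X, χ ((c : ZMod (p ^ n)) * ((k : ℕ) : ZMod (p ^ n))⁻¹) *
          gaussSum χ (ZMod.stdAddChar (N := p ^ n)) ^ 2 := by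
        refine Finset.sum_congr rfl fun χ _ ↦ ?_
        rw [← mul_inv_apply_eq χ _ hk]; ring
      rw [this]
      have hyu : IsUnit ((c : ZMod (p ^ n)) * ((k : ℕ) : ZMod (p ^ n))⁻¹) := by
        refine hcu.mul ?_
        rw [← hk.unit_spec, ZMod.inv_coe_unit]; exact Units.isUnit _
      have h := norm_sum_mul_gaussSum_sq_le_of_support hn X hsupp hyu
      rw [hβ]
      refine h.trans (le_of_eq ?_)
      push_cast; ring
    · have : Bw k = 0 := Finset.sum_eq_zero fun χ _ ↦ by rw [MulChar.map_nonunit χ⁻¹ hk, mul_zero]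
      rw [this, norm_zero]; positivity
  have h := norm_dampedTwist_le_of_norm_le f (by positivity) hBle hC hθ hθ1 ha hY'
  rw [hβ] at h
  refine h.trans (le_of_eq ?_)
  ring

end Errors

end Summit.BirchSwinnertonDyer.BirchSwinnertonDyer.Theorems.PSRohrlichAL

end
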